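import Summits.Ventures.CertifiedManyBodySolver.Theorems.CovLa214M2bApexCurveOfStationBoxRow
import HarnessLib

/-!
# Ventures/CertifiedManyBodySolver — Theorems/CovLa214M2bApexCurveOfStationSlotBoxRow.lean: WHAT ONE TIER-P VERTEX ROW WITH A FOREIGN OBJECTIVE
# SLOT BUYS ON ITS OWN — the stiffness-scale ceiling along the part `t′ ≥ σ` of the source's APEX CURVE `U·τ = (2U − 29/5)·t′` (`U ≥ 29/5`), from ONE
# box-geometry affine-N row at the station source `(t′, U) = (τ, 29/5)`, `n = 1`, whose objective is the f-sum word at the SLOT `σ` (`σ` may differ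
# from `τ`: the K2 CORNER objective `−X₀(−3/10)` of the S2′ overhang spoke at `τ = −357/740`), + the AF-HF kernel cap + the band-bottom floor at `τ`

HONEST FRAMING (wording class (xx1): CONTROL / CALIBRATION one-sided flux-stiffness-scale CEILINGS on the downfolded La₂CuO₄ parent box «La214-E»,
D-0150 M2(b), route «CovLa214M2b»). This is the SLOT generalisation of `Theorems/CovLa214M2bApexCurveOfStationBoxRow.lean` (p692799, own word
`σ = τ`): the ONLY hypothesis of every theorem is ONE single-vertex row
`SquareTTPrimeCorrAffineOrbitLowerRowN ((τ:ℚ):ℝ) (((29/5:ℚ)):ℝ) q hi lo κhi κlo s 1 univ (boxW R) (termOp (boxD R) (fsumTermsIdx σ (boxIx R)))`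
(`R ≥ 7`, `−1/2 ≤ τ < 0`, `κhi, κlo ≥ 0`) — the conclusion shape of hubbard-obs-p2's prover-seat box closers for a spoke whose SDP objective was the
f-sum word at a slot `σ` other than its own hopping `τ` (the S2′-Rm2-u″ instance `Certificates/S2RmuTierP/*`: `τ = −357/740`, `σ = tpX = −3/10`,
`R = 13`). From it, with NO further certificate and NO claim node: (§1) the row on `box 2 7` for `−X₀(σ; 29/5)` in the `(τ, 29/5)` state class
(box dictionary `termOp_boxD_fsumTermsIdx` + window shrinking `SquareTTPrimeCorrAffineOrbitLowerRowN.of_incl`), the point affine row at `n = 1`,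
and the UNCONDITIONAL orbit-lower value `reprice q hi lo κhi κlo u_AF (−4 − 4τ)` under the KERNEL window at the SOURCE (AF-HF cap plane
`laBoxE_u29o5_afCap_le`, band-bottom floor `laBoxE_kernelFloor_le`, packaged as p692799's `covLa214M2b_station29o5_pointWindow_af` at `τ`);
(§2) the APEX-CURVE leaves by hubbard-downfold-unc-2's slot engine `ObsStiffnessSeqCeilingAt_halfFilling_of_apexSource_orbitLower_slot`: for every
`U ≥ 29/5` and `U·τ = (2U − 29/5)·t′` WITH `σ ≤ t′` (slot condition `2σ − 2t′ = k·τ`, `k = (2σ − 2t′)/τ ≥ 0`), `ObsStiffnessSeqCeilingAt t′ U 1 c` for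
every `c ≥ −reprice …`. There is NO point leaf at the source when `τ < σ` (the slot condition fails there: objective/source mismatch) — for the S2′
vertex (`τ = −357/740 < σ = −3/10`) the admissible targets are `t′ ≥ −3/10`, i.e. `U ≥ 74/5` on its curve: inside «La214-E» exactly the bottom-right
corner `(−3/10, 74/5)`. NOTHING here closes K1 «SegmentFanCeiling» or K2 «TransportFanCeiling» (stmt-Ventures-26183 / 26184 quantify over 2-D regions
and are closed — if at all — by hubbard-cov-la214-unc-2's pair files from hub AND spoke rows; both stay OPEN·HELD by the pen until then); no number of
record, tier, margin, registry row or box word moves; nothing is evaluated in this file (the row is a hypothesis). A ceiling never speaks to the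
presence of superconductivity or to `ρ_s = 0`; never «certified true negative/positive»; not a `T_c` / phase / Néel sentence; nothing about La₂CuO₄
samples; no summit statement is proved by this file. ZERO compute, no definition, no `sorry`. Cell `hubbard-obs`, seat hubbard-obs-p2 g26
(`prover-hubbard-obs-p2-g26-0`), STIFFNESS seat.

References: T. Koma, H. Tasaki, J. Stat. Phys. 76 (1994) 745 §1 [KomaTasaki1994]; D. J. Scalapino, S. R. White, S.-C. Zhang, PRB 47 (1993) 7995 §II
[ScalapinoWhiteZhang1993]; S. Boyd, L. Vandenberghe, *Convex Optimization* (2004) §5.6 [BoydVandenberghe2004]; H. Araki, H. Moriya, Rev. Math. Phys. 15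
(2003) 93 §4.1 [ArakiMoriya2003]; J. Wang et al., PRX 14 (2024) 031006 §III [WangEtAl2024].
-/

noncomputable section

namespace Summit.Ventures.CertifiedManyBodySolver.Theorems

open Literature.MathematicalPhysics.QuantumLattice Literature.MathematicalPhysics.QuantumLattice.ThermodynamicLimit
open Literature.Probability.LatticeModels
open Matrix HubbardWave0 Filter Topology
open Summit.Ventures.CertifiedManyBodySolver.Observables Summit.Ventures.CertifiedManyBodySolver.Downfold
open Summit.Ventures.CertifiedManyBodySolver.Certificates
open Summit.Ventures.CertifiedManyBodySolver.CARPolyWindow Summit.Ventures.CertifiedManyBodySolver.CARPolyWindow.BoxGeom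
open scoped BigOperators ComplexOrder

/-! ## §1 From ONE box-geometry row at the source `(τ, 29/5)` with objective slot `σ` to the unconditional orbit-lower value under the kernel window -/

section StationSlotBoxRow

variable {R : ℕ} {τ σ q hi lo κhi κlo s : ℚ}

/-- **The row on `box 2 7` for the slot-`σ` f-sum word in the `(τ, 29/5)` state class.** From the box closer's conclusion on `boxW R` (`R ≥ 7`) with
the syntactic objective `termOp (boxD R) (fsumTermsIdx σ (boxIx R))` to the affine-N row on `Λ₇ = box 2 7` for `−X₀(σ; 29/5)` (box dictionary +
window shrinking). [cite: WangEtAl2024, §III] [cite: ArakiMoriya2003, §4.1 Def. 4.1 (2)] -/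
theorem covLa214M2b_station29o5_slotRowN_box7_of_boxRow (hR : 7 ≤ R)
    (hrow : SquareTTPrimeCorrAffineOrbitLowerRowN ((τ : ℚ) : ℝ) (((29 / 5 : ℚ)) : ℝ) q hi lo κhi κlo s 1 Finset.univ (boxW R)
      (termOp (boxD R) (fsumTermsIdx σ (boxIx R)))) :
    SquareTTPrimeCorrAffineOrbitLowerRowN (τ : ℝ) (29 / 5 : ℝ) q hi lo κhi κlo s 1 Finset.univ (box 2 7)
      (-oddMomentObsTT (σ : ℝ) (29 / 5 : ℝ) 0) := by
  have hU : (((29 / 5 : ℚ)) : ℝ) = 29 / 5 := by push_cast; ring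
  rw [hU, termOp_boxD_fsumTermsIdx hR σ (29 / 5 : ℝ)] at hrow
  exact hrow.of_incl _

/-- **The POINT affine row at the anchor density `n = 1`** (value `q`; the density slope drops out at the solve density), slot objective.
[cite: BoydVandenberghe2004, §5.6] -/
theorem covLa214M2b_station29o5_slotAffineRow_point_of_boxRow (hR : 7 ≤ R)
    (hrow : SquareTTPrimeCorrAffineOrbitLowerRowN ((τ : ℚ) : ℝ) (((29 / 5 : ℚ)) : ℝ) q hi lo κhi κlo s 1 Finset.univ (boxW R)
      (termOp (boxD R) (fsumTermsIdx σ (boxIx R)))) :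
    SquareTTPrimeCorrAffineOrbitLowerRow (τ : ℝ) (29 / 5 : ℝ) 1 q hi lo κhi κlo Finset.univ (box 2 7)
      (-oddMomentObsTT (σ : ℝ) (29 / 5 : ℝ) 0) := by
  have h := (covLa214M2b_station29o5_slotRowN_box7_of_boxRow hR hrow).affineOrbitLowerRow_at (x := 1) zero_le_one one_lt_two
  simp only [sub_self, mul_zero, add_zero, Rat.cast_one] at h
  exact h

/-- **The UNCONDITIONAL orbit-lower value of the slot word on the source class** (torus-limit ground states of the `(rectN 1 L, S^z = 0)` sectors of
`hubbardTorusTT' L 1 τ (29/5)`): `reprice q hi lo κhi κlo u_AF (−4 − 4τ) ≤ |D₄|⁻¹ Σ_γ Re ω_{γΛ₇}(Γ_γ(−X₀(σ; 29/5)))` — the affine row priced at the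
kernel window AT THE SOURCE `τ` (`κhi, κlo ≥ 0`). This is the `h`-premise shape of the apex slot engine with `t′_A = τ`, slot `σ`.
[cite: BoydVandenberghe2004, §5.6] -/
theorem covLa214M2b_station29o5_slotOrbitLower_of_boxRow (hR : 7 ≤ R) (hτ : -1 / 2 ≤ τ)
    (hrow : SquareTTPrimeCorrAffineOrbitLowerRowN ((τ : ℚ) : ℝ) (((29 / 5 : ℚ)) : ℝ) q hi lo κhi κlo s 1 Finset.univ (boxW R)
      (termOp (boxD R) (fsumTermsIdx σ (boxIx R)))) (hκhi : 0 ≤ κhi) (hκlo : 0 ≤ κlo) :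
    ∀ (ω : InfVolFermionState 2) (Ls : ℕ → ℕ) (ψ : ∀ L, Fock (Orb (FermionTorus 2 L))),
      Tendsto Ls atTop atTop →
      (∀ j, IsGroundStateInSector (hubbardTorusTT' (Ls j) 1 (τ : ℝ) (29 / 5)) (rectN 1 (Ls j)) 0 (ψ (Ls j))) →
      (∀ j, star (ψ (Ls j)) ⬝ᵥ ψ (Ls j) = 1) → ω.IsTorusLimitOf ψ Ls →
      ((reprice q hi lo κhi κlo (-3039267953 / 5000000000) (-4 - 4 * τ) : ℚ) : ℝ) ≤
        ((Finset.univ : Finset (DihedralGroup 4)).card : ℝ)⁻¹ * ∑ g ∈ (Finset.univ : Finset (DihedralGroup 4)),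
          (ω.expect (d4ShiftSet g 0 (box 2 7)) (fermionEmbed (PolySite.d4Emb g 0 (box 2 7)) (-oddMomentObsTT (σ : ℝ) (29 / 5 : ℝ) 0))).re := by
  intro ω Ls ψ hLs hψ h1 hω
  have h := covLa214M2b_station29o5_slotAffineRow_point_of_boxRow hR hrow ω Ls ψ hLs hψ h1 hω
  have hw := covLa214M2b_station29o5_pointWindow_af hτ
  exact (reprice_le_affine hκhi hκlo hw.1 hw.2).trans h

end StationSlotBoxRow

/-! ## §2 The APEX-CURVE leaves of the source on the slot-admissible part `t′ ≥ σ` (half filling; nothing flows toward smaller `U`) -/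

section ApexCurveSlot

variable {R : ℕ} {τ σ q hi lo κhi κlo s : ℚ}

/-- **APEX-CURVE LEAF from ONE slot-`σ` box row at the source `(τ, 29/5)`** (`−1/2 ≤ τ < 0`): for every target `(t′, U)` with `U ≥ 29/5` on the
source's apex segment `U·τ = (2U − 29/5)·t′` AND `σ ≤ t′` (slot admissibility), `ObsStiffnessSeqCeilingAt t′ U 1 c` for every
`c ≥ −reprice q hi lo κhi κlo u_AF (−4 − 4τ)` — hubbard-downfold-unc-2's slot engine at slot `σ` with `k = (2σ − 2t′)/τ ≥ 0`. For the own word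
`σ = τ` the side condition is automatic (p692799). [cite: KomaTasaki1994, §1] [cite: ScalapinoWhiteZhang1993, §II] -/
theorem covLa214M2b_station29o5_stiffnessSeqCeilingAt_apexCurve_of_slotBoxRow (hR : 7 ≤ R) (hτ : -1 / 2 ≤ τ) (hτ0 : τ < 0)
    (hrow : SquareTTPrimeCorrAffineOrbitLowerRowN ((τ : ℚ) : ℝ) (((29 / 5 : ℚ)) : ℝ) q hi lo κhi κlo s 1 Finset.univ (boxW R)
      (termOp (boxD R) (fsumTermsIdx σ (boxIx R)))) (hκhi : 0 ≤ κhi) (hκlo : 0 ≤ κlo)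
    (c : ℚ) (hc : -reprice q hi lo κhi κlo (-3039267953 / 5000000000) (-4 - 4 * τ) ≤ c)
    (tp U : ℝ) (hU : 29 / 5 ≤ U) (hapex : U * (τ : ℝ) = (2 * U - 29 / 5) * tp) (hσtp : (σ : ℝ) ≤ tp) :
    ObsStiffnessSeqCeilingAt tp U 1 c := by
  have hUpos : 0 < U := by linarith
  have hτ0' : (τ : ℝ) < 0 := by exact_mod_cast hτ0
  refine ObsStiffnessSeqCeilingAt_halfFilling_of_apexSource_orbitLower_slot (t'A := (τ : ℝ)) (UA := 29 / 5)
    (t'P := tp) (UP := U) (σ : ℝ) (29 / 5)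
    (((reprice q hi lo κhi κlo (-3039267953 / 5000000000) (-4 - 4 * τ) : ℚ) : ℝ)) (by norm_num) hU hUpos hapex
    (covLa214M2b_station29o5_slotOrbitLower_of_boxRow hR hτ hrow hκhi hκlo) (k := (2 * (σ : ℝ) - 2 * tp) / (τ : ℝ))
    (div_nonneg_of_nonpos (by linarith) hτ0'.le) ?_ c ?_
  · rw [div_mul_cancel₀ _ hτ0'.ne]
  · have : (((-reprice q hi lo κhi κlo (-3039267953 / 5000000000) (-4 - 4 * τ) : ℚ)) : ℝ) ≤ ((c : ℚ) : ℝ) := by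
      exact_mod_cast hc
    push_cast at this ⊢
    linarith

/-- **The apex curve in BOX COORDINATES with the slot side condition**: `t′·(2 − (29/5)/U) = τ`, `U ≥ 29/5`, `σ ≤ t′`. For the S2′ vertex
(`τ = −357/740`, `σ = −3/10`) the admissible box point is the bottom-right corner `(−3/10, 74/5)` of «La214-E». [cite: KomaTasaki1994, §1]
[cite: ScalapinoWhiteZhang1993, §II] -/
theorem covLa214M2b_station29o5_stiffnessSeqCeilingAt_of_apexCurve_eq_of_slotBoxRow (hR : 7 ≤ R) (hτ : -1 / 2 ≤ τ) (hτ0 : τ < 0)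
    (hrow : SquareTTPrimeCorrAffineOrbitLowerRowN ((τ : ℚ) : ℝ) (((29 / 5 : ℚ)) : ℝ) q hi lo κhi κlo s 1 Finset.univ (boxW R)
      (termOp (boxD R) (fsumTermsIdx σ (boxIx R)))) (hκhi : 0 ≤ κhi) (hκlo : 0 ≤ κlo)
    (c : ℚ) (hc : -reprice q hi lo κhi κlo (-3039267953 / 5000000000) (-4 - 4 * τ) ≤ c)
    (tp U : ℝ) (hU : 29 / 5 ≤ U) (hcurve : tp * (2 - 29 / 5 / U) = (τ : ℝ)) (hσtp : (σ : ℝ) ≤ tp) :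
    ObsStiffnessSeqCeilingAt tp U 1 c := by
  have hUpos : 0 < U := by linarith
  have hUne : U ≠ 0 := hUpos.ne'
  have hapex : U * (τ : ℝ) = (2 * U - 29 / 5) * tp := by
    have e : tp * (2 - 29 / 5 / U) * U = (2 * U - 29 / 5) * tp := by
      field_simp
    rw [← e, hcurve]
    ring
  exact covLa214M2b_station29o5_stiffnessSeqCeilingAt_apexCurve_of_slotBoxRow hR hτ hτ0 hrow hκhi hκlo c hc tp U hU hapex hσtp

/-- **The slot-admissible apex curve PARAMETRISED by the coupling**: target `t′ = τ·U/(2U − 29/5)` at every `U ≥ 29/5` with `σ·(2U − 29/5) ≥ τ·U`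
(equivalently `t′ ≥ σ`). [cite: KomaTasaki1994, §1] [cite: ScalapinoWhiteZhang1993, §II] -/
theorem covLa214M2b_station29o5_stiffnessSeqCeilingAt_apexCurve_param_of_slotBoxRow (hR : 7 ≤ R) (hτ : -1 / 2 ≤ τ) (hτ0 : τ < 0)
    (hrow : SquareTTPrimeCorrAffineOrbitLowerRowN ((τ : ℚ) : ℝ) (((29 / 5 : ℚ)) : ℝ) q hi lo κhi κlo s 1 Finset.univ (boxW R)
      (termOp (boxD R) (fsumTermsIdx σ (boxIx R)))) (hκhi : 0 ≤ κhi) (hκlo : 0 ≤ κlo)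
    (c : ℚ) (hc : -reprice q hi lo κhi κlo (-3039267953 / 5000000000) (-4 - 4 * τ) ≤ c) (U : ℝ) (hU : 29 / 5 ≤ U)
    (hslotU : (σ : ℝ) * (2 * U - 29 / 5) ≤ (τ : ℝ) * U) :
    ObsStiffnessSeqCeilingAt ((τ : ℝ) * U / (2 * U - 29 / 5)) U 1 c := by
  have hdenpos : 0 < 2 * U - 29 / 5 := by linarith
  have hden : 2 * U - 29 / 5 ≠ 0 := hdenpos.ne'
  refine covLa214M2b_station29o5_stiffnessSeqCeilingAt_apexCurve_of_slotBoxRow hR hτ hτ0 hrow hκhi hκlo c hc _ U hU ?_ ?_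
  · rw [mul_comm (2 * U - 29 / 5), div_mul_cancel₀ _ hden]
    ring
  · rw [le_div_iff₀ hdenpos]
    exact hslotU

end ApexCurveSlot

end Summit.Ventures.CertifiedManyBodySolver.Theorems

end
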